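import Literature.Computability.AlgebraicComplexity.Kron444HullCheck
import HarnessLib

/-!
# `Kron(4,4,4) ⊆ conv(328 vertices)`: certificate checks, part 1/14

Proofs file (computations only): the node checks of `Kron444HullCheck.lean` for the chunks
0 … 12 of the certificate, each decided by the kernel (`decide +kernel`; `maxHeartbeats 0`:
a chunk is ≈ 10⁵–10⁶ kernel reductions). Assembled in `Kron444Hull.lean`. [folklore]
-/

set_option Elab.async false

namespace Literature.Computability.AlgebraicComplexity.Kron444Hull

/-- The global checks pass: all vertices are normalised with positive denominators and the root
record is `{E = 0, all 270 facets ≥ 0}`. [folklore] -/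
theorem checkGlobal_true : checkGlobal = true := by
  set_option maxHeartbeats 0 in decide +kernel

/-- Nodes `0 … 24` of the certificate (chunk `0`) pass `checkNodeRec`. [folklore] -/
theorem checkChunk_0 : checkChunk 0 25 = true := by
  set_option maxHeartbeats 0 in decide +kernel

/-- Nodes `25 … 49` of the certificate (chunk `1`) pass `checkNodeRec`. [folklore] -/
theorem checkChunk_1 : checkChunk 1 25 = true := by
  set_option maxHeartbeats 0 in decide +kernel

/-- Nodes `50 … 74` of the certificate (chunk `2`) pass `checkNodeRec`. [folklore] -/
theorem checkChunk_2 : checkChunk 2 25 = true := by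
  set_option maxHeartbeats 0 in decide +kernel

/-- Nodes `75 … 99` of the certificate (chunk `3`) pass `checkNodeRec`. [folklore] -/
theorem checkChunk_3 : checkChunk 3 25 = true := by
  set_option maxHeartbeats 0 in decide +kernel

/-- Nodes `100 … 124` of the certificate (chunk `4`) pass `checkNodeRec`. [folklore] -/
theorem checkChunk_4 : checkChunk 4 25 = true := by
  set_option maxHeartbeats 0 in decide +kernel

/-- Nodes `125 … 149` of the certificate (chunk `5`) pass `checkNodeRec`. [folklore] -/
theorem checkChunk_5 : checkChunk 5 25 = true := by
  set_option maxHeartbeats 0 in decide +kernel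

/-- Nodes `150 … 174` of the certificate (chunk `6`) pass `checkNodeRec`. [folklore] -/
theorem checkChunk_6 : checkChunk 6 25 = true := by
  set_option maxHeartbeats 0 in decide +kernel

/-- Nodes `175 … 199` of the certificate (chunk `7`) pass `checkNodeRec`. [folklore] -/
theorem checkChunk_7 : checkChunk 7 25 = true := by
  set_option maxHeartbeats 0 in decide +kernel

/-- Nodes `200 … 224` of the certificate (chunk `8`) pass `checkNodeRec`. [folklore] -/
theorem checkChunk_8 : checkChunk 8 25 = true := by
  set_option maxHeartbeats 0 in decide +kernel

/-- Nodes `225 … 249` of the certificate (chunk `9`) pass `checkNodeRec`. [folklore] -/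
theorem checkChunk_9 : checkChunk 9 25 = true := by
  set_option maxHeartbeats 0 in decide +kernel

/-- Nodes `250 … 274` of the certificate (chunk `10`) pass `checkNodeRec`. [folklore] -/
theorem checkChunk_10 : checkChunk 10 25 = true := by
  set_option maxHeartbeats 0 in decide +kernel

/-- Nodes `275 … 299` of the certificate (chunk `11`) pass `checkNodeRec`. [folklore] -/
theorem checkChunk_11 : checkChunk 11 25 = true := by
  set_option maxHeartbeats 0 in decide +kernel

/-- Nodes `300 … 324` of the certificate (chunk `12`) pass `checkNodeRec`. [folklore] -/
theorem checkChunk_12 : checkChunk 12 25 = true := by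
  set_option maxHeartbeats 0 in decide +kernel

end Literature.Computability.AlgebraicComplexity.Kron444Hull
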